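import Summits.CriticalPhenomena.PercolationContinuityZ3.Theorems.PercNearOneGluingNoHeavyConstsClusterSquareQuadClashGate
import HarnessLib

/-!
# The triple-split inequality on every weighted complete bipartite graph `K₂,ₘ` (all placements of the three points)

builds on p205010 (kernel theorem, internal audit signed; external expert review pending)

PAPER-2 track "percolation constants", part (ii), seat `prim-consts-1`, gen 18 (lane index
`run/shared/lean/prim/consts/CONSTANTS.md`, row A19; memo `FROM-prim-consts-1-g18-QUAD-CLASH.md` §0(3)).
Support file for the crux `NoHeavyLowerTail` (stmt-CriticalPhenomena-4575; `--supports`).  Theorems only; no sorries.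

Vertices `Fin (m+2)`; the POLES are `0, 1`, the other `m` vertices form the second part; a weight function `w` is `K₂,ₘ`-supported if
every pair of positive weight joins a pole to a non-pole (`w` is otherwise arbitrary in `[0,1]`, so every weighted subgraph of `K₂,ₘ` is
included); the graph of the criteria is Mathlib's `SimpleGraph.fromRel (u ↦ v ↦ (u < 2 ↔ ¬ v < 2))` (no new definition).  For every such `w` and ALL vertices `a, b, c` (poles or not): CSQ and DUU at `(a; b, c)` and TS for `{a, b, c}`
(`Consts.clusterSquare_le_sq_K2m`, `Consts.sq_real_split_le_K2m`, **`Consts.tripleSplit_K2m`**).  Proof: the gate criterion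
`Consts.not_quadClash_of_gate` holds at every cluster `K ∋ a` avoiding `b, c`: if no pole lies in `K` then `K = {a}` and its boundary is
the two poles; otherwise the pole outside `K` (if any) is a gate `v` for `S = {b, c} ∖ {v}` (a non-pole steps only to poles, which are in
`K` or equal to `v`).  Gen 17's no-double-clash criterion fails here already for `K₂,₃` with `a, b, c` in the 3-part (double clashes
occur); the two same-side witness pairs of `…ConstsClusterSquareQuadClash.lean` are what is needed.
References: N. Gladkov, arXiv:2408.08457v2 (2024), Thm. 4.3 and Thm. 5.2.
-/

noncomputable section

open Classical

namespace Summit.CriticalPhenomena.PercolationContinuityZ3.Theorems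

open MeasureTheory Finset Literature.Probability.LatticeModels Literature.Probability.Percolation

namespace Consts

/-- **The gate hypothesis of `Consts.not_quadClash_of_gate` holds on `K₂,ₘ` at every cluster and every placement**, for the graph
`H = fromRel (u ↦ v ↦ (u is a pole ↔ v is not))` on `Fin (m+2)` with poles `0, 1`. [folklore] -/
theorem gate_K2m (m : ℕ) (a b c : Fin (m + 2)) :
    ∀ (K : Set (Fin (m + 2))), a ∈ K → b ∉ K → c ∉ K →
      (∀ T : Set (Fin (m + 2)), a ∈ T →
        (∀ u x, u ∈ T → (SimpleGraph.fromRel fun u v : Fin (m + 2) => (u.val < 2 ↔ ¬ v.val < 2)).Adj u x → x ∈ K → x ∈ T) →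
        K ⊆ T) →
      (∀ v₁ v₂ v₃ v₄ : Fin (m + 2), v₁ ∉ K → v₂ ∉ K → v₃ ∉ K → v₄ ∉ K →
          (∃ k, k ∈ K ∧ (SimpleGraph.fromRel fun u v : Fin (m + 2) => (u.val < 2 ↔ ¬ v.val < 2)).Adj k v₁) →
          (∃ k, k ∈ K ∧ (SimpleGraph.fromRel fun u v : Fin (m + 2) => (u.val < 2 ↔ ¬ v.val < 2)).Adj k v₂) →
          (∃ k, k ∈ K ∧ (SimpleGraph.fromRel fun u v : Fin (m + 2) => (u.val < 2 ↔ ¬ v.val < 2)).Adj k v₃) →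
          (∃ k, k ∈ K ∧ (SimpleGraph.fromRel fun u v : Fin (m + 2) => (u.val < 2 ↔ ¬ v.val < 2)).Adj k v₄) →
          v₁ ≠ v₂ → v₁ ≠ v₃ → v₁ ≠ v₄ → v₂ ≠ v₃ → v₂ ≠ v₄ → v₃ ≠ v₄ → False) ∨
      (∃ (v : Fin (m + 2)) (S : Set (Fin (m + 2))), (b ≠ v → b ∈ S) ∧ (c ≠ v → c ∈ S) ∧
          (∀ u x, u ∈ S → (SimpleGraph.fromRel fun u v : Fin (m + 2) => (u.val < 2 ↔ ¬ v.val < 2)).Adj u x →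
            x ∉ K → x ≠ v → x ∈ S) ∧
          (∀ y, y ∈ S → y ≠ b → y ≠ c →
            (∃ k, k ∈ K ∧ (SimpleGraph.fromRel fun u v : Fin (m + 2) => (u.val < 2 ↔ ¬ v.val < 2)).Adj k y) → False)) := by
  intro K ha hb hc hconn
  set H : SimpleGraph (Fin (m + 2)) := SimpleGraph.fromRel fun u v : Fin (m + 2) => (u.val < 2 ↔ ¬ v.val < 2) with hHdef
  -- an `H`-step changes the side
  have hside : ∀ {u x : Fin (m + 2)}, H.Adj u x → (u.val < 2 ↔ ¬ x.val < 2) := by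
    intro u x hux
    rw [hHdef, SimpleGraph.fromRel_adj] at hux
    rcases hux.2 with h | h
    · exact h
    · constructor
      · intro hu hx; exact (h.1 hx) hu
      · intro hx; by_contra hu; exact hx (h.2 hu)
  set P0 : Fin (m + 2) := ⟨0, by omega⟩ with hP0
  set P1 : Fin (m + 2) := ⟨1, by omega⟩ with hP1
  have hpole : ∀ x : Fin (m + 2), x.val < 2 → x = P0 ∨ x = P1 := by
    intro x hx
    have h : x.val = 0 ∨ x.val = 1 := by omega
    rcases h with h | h
    · exact Or.inl (Fin.ext h)
    · exact Or.inr (Fin.ext h)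
  by_cases h0 : P0 ∈ K <;> by_cases h1 : P1 ∈ K
  · -- both poles in `K`: `S = {b, c}` is closed (non-poles step only to poles)
    refine Or.inr ⟨a, {x | x = b ∨ x = c}, fun _ => Or.inl rfl, fun _ => Or.inr rfl, ?_, ?_⟩
    · intro u x hu hux hxK _
      have huK : u ∉ K := by rcases hu with rfl | rfl <;> assumption
      have hupart : ¬ u.val < 2 := by
        intro hu2
        rcases hpole u hu2 with rfl | rfl
        · exact huK h0
        · exact huK h1
      have hx2 : x.val < 2 := by by_contra h; exact hupart ((hside hux).2 h)
      rcases hpole x hx2 with rfl | rfl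
      · exact absurd h0 hxK
      · exact absurd h1 hxK
    · rintro y (rfl | rfl) hyb hyc - <;> simp_all
  · -- `P0 ∈ K`, `P1 ∉ K`: gate `v = P1`
    refine Or.inr ⟨P1, {x | (x = b ∨ x = c) ∧ x ≠ P1}, fun h => ⟨Or.inl rfl, h⟩, fun h => ⟨Or.inr rfl, h⟩, ?_, ?_⟩
    · rintro u x ⟨hu, huP1⟩ hux hxK hxP1
      have huK : u ∉ K := by rcases hu with rfl | rfl <;> assumption
      have hupart : ¬ u.val < 2 := by
        intro hu2
        rcases hpole u hu2 with rfl | rfl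
        · exact huK h0
        · exact huP1 rfl
      have hx2 : x.val < 2 := by by_contra h; exact hupart ((hside hux).2 h)
      rcases hpole x hx2 with rfl | rfl
      · exact absurd h0 hxK
      · exact absurd rfl hxP1
    · rintro y ⟨rfl | rfl, -⟩ hyb hyc - <;> simp_all
  · -- `P0 ∉ K`, `P1 ∈ K`: gate `v = P0`
    refine Or.inr ⟨P0, {x | (x = b ∨ x = c) ∧ x ≠ P0}, fun h => ⟨Or.inl rfl, h⟩, fun h => ⟨Or.inr rfl, h⟩, ?_, ?_⟩
    · rintro u x ⟨hu, huP0⟩ hux hxK hxP0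
      have huK : u ∉ K := by rcases hu with rfl | rfl <;> assumption
      have hupart : ¬ u.val < 2 := by
        intro hu2
        rcases hpole u hu2 with rfl | rfl
        · exact huP0 rfl
        · exact huK h1
      have hx2 : x.val < 2 := by by_contra h; exact hupart ((hside hux).2 h)
      rcases hpole x hx2 with rfl | rfl
      · exact absurd rfl hxP0
      · exact absurd h1 hxK
    · rintro y ⟨rfl | rfl, -⟩ hyb hyc - <;> simp_all
  · -- no pole in `K`: then `a` is not a pole, `K = {a}`, and the boundary of `K` consists of the two poles
    have hapart : ¬ a.val < 2 := by
      intro ha2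
      rcases hpole a ha2 with rfl | rfl
      · exact h0 ha
      · exact h1 ha
    have hKa : K ⊆ {a} := by
      refine hconn {a} rfl ?_
      rintro u x rfl hux hxK
      have hx2 : x.val < 2 := by by_contra h; exact hapart ((hside hux).2 h)
      rcases hpole x hx2 with rfl | rfl
      · exact absurd hxK h0
      · exact absurd hxK h1
    refine Or.inl fun v₁ v₂ v₃ _ _ _ _ _ ⟨k₁, hk₁, hkv₁⟩ ⟨k₂, hk₂, hkv₂⟩ ⟨k₃, hk₃, hkv₃⟩ _ h12 h13 _ h23 _ _ => ?_
    have hk : ∀ {k v : Fin (m + 2)}, k ∈ K → H.Adj k v → v = P0 ∨ v = P1 := by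
      intro k v hkK hkv
      have hka : k = a := hKa hkK
      rw [hka] at hkv
      exact hpole v (by by_contra h; exact hapart ((hside hkv).2 h))
    rcases hk hk₁ hkv₁ with rfl | rfl <;> rcases hk hk₂ hkv₂ with rfl | rfl <;> rcases hk hk₃ hkv₃ with rfl | rfl <;>
      first | exact h12 rfl | exact h13 rfl | exact h23 rfl

/-- The graph `fromRel (pole ↔ non-pole)` carries the positive pairs of a `K₂,ₘ`-supported weight function. [folklore] -/
theorem adj_fromRel_pole_of_pos {m : ℕ} (w : Sym2 (Fin (m + 2)) → unitInterval)
    (hw : ∀ u v : Fin (m + 2), u ≠ v → (0 : ℝ) < w s(u, v) → (u.val < 2 ↔ ¬ v.val < 2)) :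
    ∀ u v : Fin (m + 2), u ≠ v → (0 : ℝ) < w s(u, v) →
      (SimpleGraph.fromRel fun u v : Fin (m + 2) => (u.val < 2 ↔ ¬ v.val < 2)).Adj u v := by
  intro u v huv hpos
  rw [SimpleGraph.fromRel_adj]
  exact ⟨huv, Or.inl (hw u v huv hpos)⟩

/-- **TS on every weighted `K₂,ₘ`, every placement**: if every pair of positive weight joins a pole (`0` or `1`) to a non-pole, then
`μ(a|b|c)² ≤ μ(a↮b)·μ(a↮c)·μ(b↮c)` for all `a, b, c : Fin (m+2)`. [cite: Gladkov2024, Thm. 4.3 and Thm. 5.2; derived here] -/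
theorem tripleSplit_K2m (m : ℕ) (w : Sym2 (Fin (m + 2)) → unitInterval)
    (hw : ∀ u v : Fin (m + 2), u ≠ v → (0 : ℝ) < w s(u, v) → (u.val < 2 ↔ ¬ v.val < 2)) (a b c : Fin (m + 2)) :
    (prodBernoulli w).real ((openConn a b)ᶜ ∩ (openConn a c)ᶜ ∩ (openConn b c)ᶜ) ^ 2 ≤
      (prodBernoulli w).real (openConn a b)ᶜ * (prodBernoulli w).real (openConn a c)ᶜ *
        (prodBernoulli w).real (openConn b c)ᶜ :=
  tripleSplit_of_gate w a b c _ (adj_fromRel_pole_of_pos w hw) (gate_K2m m a b c)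

/-- **CSQ at `(a; b, c)` on every weighted `K₂,ₘ`.** [cite: Gladkov2024, Thm. 4.3; derived here] -/
theorem clusterSquare_le_sq_K2m (m : ℕ) (w : Sym2 (Fin (m + 2)) → unitInterval)
    (hw : ∀ u v : Fin (m + 2), u ≠ v → (0 : ℝ) < w s(u, v) → (u.val < 2 ↔ ¬ v.val < 2)) (a b c : Fin (m + 2)) :
    clusterSquare w a b c ≤ (prodBernoulli w).real (openConn b c)ᶜ ^ 2 :=
  clusterSquare_le_sq_of_gate w a b c _ (adj_fromRel_pole_of_pos w hw) (gate_K2m m a b c)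

/-- **DUU at `(a; b, c)` on every weighted `K₂,ₘ`.** [cite: Gladkov2024, Thm. 5.2 and Thm. 4.3; derived here] -/
theorem sq_real_split_le_K2m (m : ℕ) (w : Sym2 (Fin (m + 2)) → unitInterval)
    (hw : ∀ u v : Fin (m + 2), u ≠ v → (0 : ℝ) < w s(u, v) → (u.val < 2 ↔ ¬ v.val < 2)) (a b c : Fin (m + 2)) :
    (prodBernoulli w).real ((openConn a b)ᶜ ∩ (openConn a c)ᶜ ∩ (openConn b c)ᶜ) ^ 2 ≤
      (prodBernoulli w).real ((openConn a b)ᶜ ∩ (openConn a c)ᶜ) * (prodBernoulli w).real (openConn b c)ᶜ ^ 2 :=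
  sq_real_split_le_of_gate w a b c _ (adj_fromRel_pole_of_pos w hw) (gate_K2m m a b c)

end Consts

end Summit.CriticalPhenomena.PercolationContinuityZ3.Theorems
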